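import Summits.Langlands.Langlands.Theses.IrreducibilityBySelfDuality
import Summits.Langlands.Langlands.Theorems.IrreducibilityBySelfDualityGaloisRepGL2CMaeOfFacts

/-!
# `GaloisRepGL2CMae` (stmt-Langlands-16722) BY NAME, conditionally on the four named facts of line `Sketch`

Route `IrreducibilityBySelfDuality`, crux item stmt-Langlands-16722, line `Sketch`
(`Cruxes/GaloisRepGL2CMae/Lines/Sketch.lean`, lead c1).  The line's skeleton proves the route decl
`Summit.Langlands.Langlands.Theses.IrreducibilityBySelfDuality.GaloisRepGL2CMae` from seven registered
stubs; three are landed theorems (`GaloisRepGL2CMae.stub_firstLemma` p138242, `.stub_thm713` p138257,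
`.stub_patching` p138800) and the conditional closure of the BODY of the decl from the four remaining
ones — all printed theorems held as named facts without `_holds` — is the landed
`GaloisRepGL2CMae.galoisRepGL2CMae_of_facts` (p139112).  This file records the same closure with the
route decl AS THE CONCLUSION TYPE, so that the gate's audit sees the crux closed CONDITIONALLY on exactly

* `HarrisLanTaylorThorne2016_twistedPairLimit_two` — (α)₂, Harris–Lan–Taylor–Thorne 2016 §6 at `n = 2`
  (Lemma 6.2–Cor. 6.4, Cor. 6.23–6.26; the Galois-free half of Cor. 6.27);
* `HarrisLanTaylorThorne2016_corollary13_cuspidalUnitary` — (β′), HLTT Cor. 1.3 (second alternative) for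
  cuspidal representations of the quasi-split unitary group in `2n` variables, regular discrete series;
* `ArthurClozel1989_strongLifting_archimedean` — Arthur–Clozel Ch. 3 Thm. 5.1 with Ch. 1 §7 (used at `n = 2`;
  = route item `ACStrongLiftingArchimedean`, 15021);
* `ArthurClozel1989_strongLifting_cuspidal` — Arthur–Clozel Ch. 3 Thm. 4.2 (a)/5.1 (used at `n = 2`;
  = route item `ACStrongCuspidalBaseChangePrime`, 15022).

Nothing is assumed beyond these four hypotheses (registered sub-goal `GaloisRepGL2CMae_of_facts'` of the
crux item); the day their `_holds` land, `GaloisRepGL2CMae_of_facts' X₁_holds X₂_holds X₅_holds X₆_holds`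
closes the item.

References: M. Harris, K.-W. Lan, R. Taylor, J. Thorne, Res. Math. Sci. 3:37 (2016), Thm. A (p. 3),
Cor. 1.3 (p. 31), Lemma 6.2 (pp. 197–198), Cor. 6.26–6.27 (p. 225), Thm. 7.13–Cor. 7.14 (p. 232)
[HarrisLanTaylorThorneRMS2016]; J. Arthur, L. Clozel, Ann. of Math. Stud. 120 (1989), Ch. 3
[ArthurClozelAMS120].
-/

noncomputable section

set_option linter.dupNamespace false -- project-wide option; `Summit.Langlands.Langlands` is the mandated namespace (D-0017)

namespace Summit.Langlands.Langlands.Theorems.GaloisRepGL2CMae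

/-- **The crux `GaloisRepGL2CMae` by name, conditionally on the four named facts of line `Sketch`**
(HLTT §6 at `n = 2`, HLTT Cor. 1.3 for cuspidal unitary representations, and Arthur–Clozel's two
base-change clauses): the landed `galoisRepGL2CMae_of_facts` (p139112) followed by the `δ`-unfolding of
the route decl to its body.  CONDITIONAL result (four named-fact hypotheses, no `_holds` yet).
[cite: HarrisLanTaylorThorneRMS2016, Thm. A (p. 3), Cor. 1.3 (p. 31), §6 Lemma 6.2 and Cor. 6.26–6.27 (pp. 197–198, 225), Thm. 7.13–Cor. 7.14 (p. 232)]
[cite: ArthurClozelAMS120, Ch. 3 Thm. 4.2 (a), Thm. 5.1 and Ch. 1 §7] -/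
theorem GaloisRepGL2CMae_of_facts' : Literature.NumberTheory.Automorphic.HarrisLanTaylorThorne2016_twistedPairLimit_two → Literature.NumberTheory.Automorphic.HarrisLanTaylorThorne2016_corollary13_cuspidalUnitary → Literature.NumberTheory.Automorphic.ArthurClozel1989_strongLifting_archimedean → Literature.NumberTheory.Automorphic.ArthurClozel1989_strongLifting_cuspidal → Summit.Langlands.Langlands.Theses.IrreducibilityBySelfDuality.GaloisRepGL2CMae :=
  fun h₁ h₂ h₅ h₆ ↦ galoisRepGL2CMae_of_facts h₁ h₂ h₅ h₆

/-- The same closure read off the ROUTE'S OWN leaf items for the Arthur–Clozel half: the crux by name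
from (α)₂, (β′) and the route items `ACStrongLiftingArchimedean` (15021) and
`ACStrongCuspidalBaseChangePrime` (15022), whose texts are the two Arthur–Clozel facts verbatim.
CONDITIONAL result. [cite: HarrisLanTaylorThorneRMS2016, Cor. 6.27 (p. 225) and Cor. 7.14 (p. 232)] -/
theorem GaloisRepGL2CMae_of_facts_of_items
    (h₁ : Literature.NumberTheory.Automorphic.HarrisLanTaylorThorne2016_twistedPairLimit_two)
    (h₂ : Literature.NumberTheory.Automorphic.HarrisLanTaylorThorne2016_corollary13_cuspidalUnitary)
    (i₅ : Summit.Langlands.Langlands.Theses.IrreducibilityBySelfDuality.ACStrongLiftingArchimedean)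
    (i₆ : Summit.Langlands.Langlands.Theses.IrreducibilityBySelfDuality.ACStrongCuspidalBaseChangePrime) :
    Summit.Langlands.Langlands.Theses.IrreducibilityBySelfDuality.GaloisRepGL2CMae :=
  galoisRepGL2CMae_of_facts h₁ h₂ i₅ i₆

end Summit.Langlands.Langlands.Theorems.GaloisRepGL2CMae

end
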